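import Literature.MathematicalPhysics.QuantumFieldTheory.Balaban1983to89.B2Lemma23HiggsLattice
import Literature.MathematicalPhysics.QuantumFieldTheory.Balaban1983to89.B2Eq265CentredBox

/-!
# `Balaban1983to89.B2Lemma23From255` — [Balaban1982Higgs2] **Lemma 2.3** (2.59)–(2.60) p.571 «Under the restrictions (2.55)» for the
# cut-off minimizer (3.3)/(2.54) ON THE (Higgs)₂,₃ CARRIER with (2.55)₁,₂ in their PRINTED, LOCAL form — a per-bond bound
# «|(∂A)(b)| ≦ c₁p(L^{k−1}ε)» and a sup bound «|A(x)| ≦ (c₁/(μ₀L^{k−1}ε))p(L^{k−1}ε)» on `Λ₋₁^{(k−1)′}` (the typer's `B2Eq255Concrete.Restr255`,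
# conjuncts 1–2) — instead of the integrated variation modulus `q(r₁ + r₂|y − y′|)` of r14's `B2Lemma23HiggsLattice.lemma23_higgsLattice`:
# the modulus is DERIVED by telescoping along lattice paths inside the cube of radius `R_n ≥ ρ + 1` about `y` (which (2.8) puts inside
# `Λ₋₁`), and r14's theorem is applied point by point (`lemma23_local`, `lemma23_restr255`)

statement-level skeleton of published theorems with citation tags; proofs where landed; nothing here is a claim
about the Yang–Mills mass gap

PDF held: `paper:balaban1982-cmp86-higgs23-ii` (journal page = PDF page + 554), p. 571 [PDF 17] (Lemma 2.3, text layer p0017 L8–11), p. 570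
[PDF 16] ((2.55), L2–5), p. 566 [PDF 12] ((2.44)), p. 558 [PDF 4] ((2.7)/(2.8): the regions and the radius `r(Lᵏε)`).

CITATION HEADER (lean-in-tree rule).  T. Bałaban, *(Higgs)₂,₃ quantum fields in a finite volume. II. An upper bound*,
Commun. Math. Phys. **86** (1982) 555–594, doi:10.1007/bf01214890 [Balaban1982Higgs2].  Cell `lit-balaban` (HOME
`run/shared/lean/pub/lit-balaban/`), Phase-2 proof seat **p23** gen 22 (unit `lit-balaban-p23-g22`; free-target protocol G.5-34(d), TAKING #4
line HOME/STATUS.md 2026-08-23); SKELETON row **B2.Lem2.3** (fold owner r02, second reader r14; head UNCHANGED — cells-only member next to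
r14's `B2Lemma23HiggsLattice` (p312208), whose HONEST SCOPE (ii) «(2.55) enters in the INTEGRATED reading» it narrows).  USED BY NAME, never
restated: r14's `B2Lemma23HiggsLattice.{cutMin, lemma23_higgsLattice}` and `B1Eq211ZeroFieldTorus.Shape`; own `B2Eq265GaugedLipschitz.
lipschitz_about_of_bond_bound` (telescoping in a box of `T^{(k)}`) and `B2Eq265CentredBox.{tdist_ge_of_not_mem_box, mem_box_of_centre}`
(the centred cube); the typer's `B2Eq255Concrete.{Restr255, dA, absA}`, `B3MultiscaleFields.toSite`, `HiggsLattice.{sderiv, Site.tdist}`.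

THE ARGUMENT.  Fix `y ∈ Λ₂` and let `◇ = y + [−R_n, R_n]ᵈ ⊂ T^{(k)}` be the cube of coarse sites of radius `R_n` about `y`
(`2(2R_n+1) ≤ |T^{(k)}|_μ`), assumed inside `Λ₋₁` (print (2.8): `Λ₋₁` contains the `r(Lᵏε)`-collar of `Λ₂`, and `ρ + 1 ≤ R_n` where
`ρ < r(Lᵏε)` is the support radius (2.44) of `ζ^{(k)}`).  On `◇` the per-bond bound `‖A(b₊) − A(b₋)‖ = (Lᵏε)‖(∂A)(b)‖ ≤ (Lᵏε)g`
telescopes to `‖A(y′) − A(y)‖ ≤ (Lᵏε)g·d·|y − y′|` (`lipschitz_about_of_bond_bound`; a site within torus distance `R_n` of the centre lies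
in `◇`, `mem_box_of_tdist_le`, and conversely `tdist_le_of_mem_box`).  So r14's `lemma23_higgsLattice` applies with ITS regions
`Λ₂ := {y}`, `Λ₁ := ◇` and `q := (Lᵏε)g`, `r₁ := 0`, `r₂ := d`, giving (2.59)/(2.60) at every `x ∈ Bᵏ(y)` with the constant
`C₁·d·(Lᵏε)g + C₂e^{−δρ₁}t_A` — for every `y ∈ Λ₂` with the same constants.

WHAT THIS FILE PROVES (kernel-checked, zero `sorry`; theorems only — NO definition, NO `Prop`-valued fact; axioms standard).
 §1 `norm_sub_eq_mesh_mul_norm_sderiv`, `val_centre_sub`, `mem_box_of_tdist_le`, `tdist_le_of_mem_box` (the cube `◇` of radius `R_n`).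
 §2 **`lemma23_local`** — r14's `lemma23_higgsLattice` with the block-field hypotheses REPLACED by: a radius `R_n` with `ρ + 1 ≤ R_n`,
    `2(2R_n+1) ≤ |T^{(k)}|_μ`, the cube condition `y ∈ Λ₂ → |y − y′| ≤ R_n → y′ ∈ Λ₁`, a sup bound `‖A(y′)‖ ≤ t_A` on `Λ₁` and a
    per-bond bound `‖(∂A)(b)‖ ≤ g` on the bonds inside `Λ₁`; conclusions (2.59) `≤ C₁·d·((Lᵏε)g) + C₂e^{−δρ₁}t_A + (μ₀²(Lᵏε)²/(a_k +
    μ₀²(Lᵏε)²))t_A` and (2.60) `≤ L^{−k}(C₁·d·((Lᵏε)g) + C₂e^{−δρ₁}t_A)`.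
 §3 **`lemma23_restr255`** — the same for the step's vector field `A′` (block field `toSite A′`, `N = d`) under the typer's
    `Restr255 C′ c₁ pℓ t_A tPhi k Λ₁ A′ φ A^{(k)}` (conjuncts 1–2: `g := c₁pℓ`, `t_A := c₁·t_A·pℓ`).

HONEST SCOPE / DIFFERENCES FROM PRINT (recorded, not hidden; one sentence each).  (a) The statement is on r14's TORUS SUB-FAMILY and
inherits all of r14's HONEST SCOPE: `Shape P` (`M·L′_μ = Lᵐ`), odd `L > 1`, `1 ≤ k ≤ K`, `Lᵏε ≤ ε₀`, ZERO EXTERNAL FIELD in `G_k`, `Q_k^*`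
(= the vector-field case, part I p.608), block-label distances, the `ζ^{(k)}` data with the printed (2.44) properties as hypotheses, the
constants `δ, C₁, C₂` existential from p14's decay bounds — NOTHING is minted here (`δ, C₁, C₂` ARE r14's).  (b) PRINT'S REGIONS are replaced,
point by point, by `Λ₂ := {x_k}` and `Λ₁ :=` the cube `◇` of coarse sites of radius `R_n` about `x_k` when r14's theorem is invoked; in the
statement this shows as the binder `R_n` with `ρ + 1 ≤ R_n`, `2(2R_n+1) ≤ |T^{(k)}|_μ` (the cube smaller than half the torus — what the
telescoping needs) and the CUBE CONDITION `y ∈ Λ₂ ∧ |y − y′| ≤ R_n ⇒ y′ ∈ Λ₁` in place of r14's `(ρ+1)`-neighbourhood condition — the user's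
reading of (2.8) p.558 (`Λ₋₁^{(k−1)′} ⊇` the `r(Lᵏε)`-collar of `Λ₂^{(k−1)′}`; `ρ < r(Lᵏε) − 2M` by (2.44)).  (c) The factor `d` and the modulus
`q := (Lᵏε)g` (`r₁ := 0`, `r₂ := d`) come from the ℓ¹-path telescoping of own F6 `B2Eq265GaugedLipschitz.lipschitz_about_of_bond_bound` in `◇`
(sup-metric distance (1.3)).  (d) The (2.63) mass-correction term `(μ₀²(Lᵏε)²/(a_k + μ₀²(Lᵏε)²))t_A` STAYS in (2.59) as r14 has it (print absorbs it
into `O(p(Lᵏε))`); the thresholds `g, t_A` (resp. `c₁, pℓ, t_A` of `Restr255`) are free letters, the printed instance being `Restr255Printed`;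
the conversion of the terms into print's `O(p(Lᵏε))` (`rDecayBeatsPowers`) is row B2.Lem2.3's, not repeated.  NOT summit progress.
-/

open scoped BigOperators

noncomputable section

namespace Literature.MathematicalPhysics.QuantumFieldTheory.Balaban1983to89.B2Lemma23From255

open HiggsLattice (ChargeData sderiv)
open HiggsAveraging (blockIter)
open HiggsCovariancePos (Inside)
open B2Eq255Concrete (Restr255 dA absA)
open B2Lemma23HiggsLattice (cutMin lemma23_higgsLattice)
open B1Eq211ZeroFieldTorus (Shape)
open B3MultiscaleFields (toSite)
open B2Eq265GaugedLipschitz (lipschitz_about_of_bond_bound)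
open B2Eq265CentredBox (tdist_ge_of_not_mem_box mem_box_of_centre)

variable {P : HiggsLattice.Params} {k : ℕ}

/-! ## §1 The cube `◇` of radius `R_n` about a coarse site -/

section Cube

/-- **(I.1.4) unfolded under the norm**: `‖f(b₊) − f(b₋)‖ = η·‖(∂^ηf)(b)‖`, `η = Lᵏε`. [cite: Balaban1982Higgs1, (1.4) p.604] -/
theorem norm_sub_eq_mesh_mul_norm_sderiv {E : Type*} [NormedAddCommGroup E] [NormedSpace ℝ E] (f : HiggsLattice.Site P k → E)
    (b : HiggsLattice.PBond P k) : ‖f b.tgt - f b.src‖ = P.mesh k * ‖sderiv f b‖ := by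
  have hm : 0 < P.mesh k := P.mesh_pos k
  unfold sderiv
  rw [norm_smul, Real.norm_eq_abs, abs_of_pos (inv_pos.mpr hm), ← mul_assoc, mul_inv_cancel₀ hm.ne', one_mul]

/-- the corner `q₁ = ȳ − R_n·(1,…,1)` of the cube of radius `R_n` about `ȳ`: `n_ν(ȳ − q₁) = R_n` (no wrap: `2(2R_n+1) ≤ |T^{(k)}|_ν`).
[cite: Balaban1982Higgs1, (1.2)–(1.3) p.604] -/
theorem val_centre_sub (ybar : HiggsLattice.Site P k) (Rn : ℕ) (hRn : ∀ μ : Fin P.d, 2 * (2 * Rn + 1) ≤ P.sitesPerDir k μ)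
    (ν : Fin P.d) : (ybar ν - (ybar ν - (Rn : ZMod (P.sitesPerDir k ν)))).val = Rn := by
  have h : ybar ν - (ybar ν - (Rn : ZMod (P.sitesPerDir k ν))) = (Rn : ZMod (P.sitesPerDir k ν)) := by ring
  rw [h, ZMod.val_natCast]
  have := hRn ν
  exact Nat.mod_eq_of_lt (by omega)

/-- **a site within torus distance `R_n` of the centre lies in the cube** `q₁ + [0, 2R_n+1)ᵈ` (contrapositive of
`B2Eq265CentredBox.tdist_ge_of_not_mem_box`). [cite: Balaban1982Higgs1, (1.3) p.604] -/
theorem mem_box_of_tdist_le (q₁ ybar : HiggsLattice.Site P k) (Rn : ℕ) (hcentre : ∀ ν : Fin P.d, (ybar ν - q₁ ν).val = Rn)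
    {y : HiggsLattice.Site P k} (hy : HiggsLattice.Site.tdist ybar y ≤ Rn) : ∀ ν : Fin P.d, (y ν - q₁ ν).val < 2 * Rn + 1 := by
  by_contra h
  have := tdist_ge_of_not_mem_box q₁ ybar Rn hcentre h
  omega

/-- **a site of the cube is within torus distance `R_n` of the centre** (each coordinate offset differs from `R_n` by at most `R_n`;
no wrap: `2(2R_n+1) ≤ |T^{(k)}|_ν`). [cite: Balaban1982Higgs1, (1.3) p.604] -/
theorem tdist_le_of_mem_box (q₁ ybar : HiggsLattice.Site P k) (Rn : ℕ) (hRn : ∀ μ : Fin P.d, 2 * (2 * Rn + 1) ≤ P.sitesPerDir k μ)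
    (hcentre : ∀ ν : Fin P.d, (ybar ν - q₁ ν).val = Rn) {y : HiggsLattice.Site P k}
    (hy : ∀ ν : Fin P.d, (y ν - q₁ ν).val < 2 * Rn + 1) : HiggsLattice.Site.tdist ybar y ≤ Rn := by
  unfold HiggsLattice.Site.tdist
  refine Finset.sup_le fun ν _ => ?_
  haveI : NeZero (P.sitesPerDir k ν) := ⟨(P.sitesPerDir_pos k ν).ne'⟩
  have hn := hRn ν
  have ha := hy ν
  have hc := hcentre ν
  by_cases hle : Rn ≤ (y ν - q₁ ν).val
  · -- `y` beyond the centre in direction `ν`: `n(y_ν − ȳ_ν) = a − R_n ≤ R_n`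
    have e : y ν - ybar ν = (y ν - q₁ ν) - (ybar ν - q₁ ν) := by ring
    have h1 : (y ν - ybar ν).val = (y ν - q₁ ν).val - Rn := by
      rw [e, ZMod.val_sub (by rw [hc]; exact hle), hc]
    refine le_trans (min_le_right _ _) ?_
    rw [h1]; omega
  · -- `y` before the centre: `n(ȳ_ν − y_ν) = R_n − a ≤ R_n`
    push Not at hle
    have e : ybar ν - y ν = (ybar ν - q₁ ν) - (y ν - q₁ ν) := by ring
    have h1 : (ybar ν - y ν).val = Rn - (y ν - q₁ ν).val := by
      rw [e, ZMod.val_sub (by rw [hc]; exact hle.le), hc]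
    refine le_trans (min_le_left _ _) ?_
    rw [h1]; omega

end Cube

/-! ## §2 Lemma 2.3 with the local form of (2.55)₁,₂ -/

section Local

/-- **LEMMA 2.3 (2.59)–(2.60) ON THE CARRIER, LOCAL HYPOTHESES.**  r14's `B2Lemma23HiggsLattice.lemma23_higgsLattice` with its block-field
hypotheses — `Λ₂ ⊆ Λ₁`, the `(ρ+1)`-neighbourhood condition, `‖A_k(y′)‖ ≤ t_A` on `Λ₁`, `‖A_k(y′) − A_k(y)‖ ≤ q(r₁ + r₂|y − y′|)` —
REPLACED by: a radius `R_n` with `ρ + 1 ≤ R_n` and `2(2R_n+1) ≤ |T^{(k)}|_μ`, the cube condition `y ∈ Λ₂ → |y − y′| ≤ R_n → y′ ∈ Λ₁`,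
the sup bound `‖A_k(y′)‖ ≤ t_A` on `Λ₁` and the PER-BOND bound `‖(∂A_k)(b)‖ ≤ g` on the bonds inside `Λ₁` ((2.55)₁,₂ as printed:
«|(∂A)(b)| ≦ c₁p(L^{k−1}ε), |A(x)| ≦ (c₁/(μ₀L^{k−1}ε))p(L^{k−1}ε) … for x ∈ Λ₋₁^{(k−1)′}, b ⊂ Λ₋₁^{(k−1)′}»); the printed (2.44) data of
`ζ^{(k)}` and everything else VERBATIM.  Conclusions: (2.59) `‖A^{(k),ε}(x) − A_k(x_k)‖ ≤ C₁·d·((Lᵏε)g) + C₂e^{−δρ₁}t_A +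
(μ₀²(Lᵏε)²/(a_k + μ₀²(Lᵏε)²))t_A` and (2.60) `‖A^{(k),ε}(x + εe_ν) − A^{(k),ε}(x)‖ ≤ L^{−k}(C₁·d·((Lᵏε)g) + C₂e^{−δρ₁}t_A)` for `x_k ∈ Λ₂`
(r14's constants; `q := (Lᵏε)g`, `r₁ := 0`, `r₂ := d` by telescoping in the cube about `x_k`).
[cite: Balaban1982Higgs2, Lemma 2.3 (2.59)–(2.60) p.571, (2.55) p.570, (2.44) p.566, (2.54) p.569, (3.3) p.583, (2.8) p.558] -/
theorem lemma23_local (d L N : ℕ) (hd : 1 ≤ d) (hL : Odd L ∧ 1 < L) {a : ℝ} (ha : 0 < a) {msq : ℝ} (hmsq : 0 < msq) (ε₀ : ℝ) :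
    ∃ δ C₁ C₂ : ℝ, 0 < δ ∧ 0 < C₁ ∧ 0 < C₂ ∧ ∀ (P : HiggsLattice.Params) (_S : Shape P), P.d = d → P.L = L →
      ∀ (C : ChargeData N) {k : ℕ}, 1 ≤ k → k ≤ P.K → P.mesh k ≤ ε₀ →
      ∀ (ζ : HiggsLattice.Site P 0 → HiggsLattice.Site P k → ℝ) (ρ ρ₁ : ℝ), 0 ≤ ρ₁ →
        (∀ x y', |ζ x y'| ≤ 1) →
        (∀ x y', ζ x y' ≠ 0 → (HiggsLattice.Site.tdist (blockIter k x) y' : ℝ) ≤ ρ) →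
        (∀ x y', (HiggsLattice.Site.tdist (blockIter k x) y' : ℝ) ≤ ρ₁ → ζ x y' = 1) →
        (∀ (x : HiggsLattice.Site P 0) (ν : Fin P.d) (y' : HiggsLattice.Site P k), |ζ (x.shift ν) y' - ζ x y'| ≤ ((P.L : ℝ) ^ k)⁻¹) →
      -- the cube of radius `R_n ≥ ρ + 1` about every `y ∈ Λ₂` lies in `Λ₁`
      ∀ (Λ₁ Λ₂ : Finset (HiggsLattice.Site P k)) (Rn : ℕ), ρ + 1 ≤ (Rn : ℝ) → (∀ μ : Fin P.d, 2 * (2 * Rn + 1) ≤ P.sitesPerDir k μ) →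
        (∀ y ∈ Λ₂, ∀ y' : HiggsLattice.Site P k, HiggsLattice.Site.tdist y y' ≤ Rn → y' ∈ Λ₁) →
      -- (2.55)₁,₂ on `Λ₁`: sup bound and per-bond derivative bound
      ∀ (A : HiggsLattice.ScalarField P k N) (tA g : ℝ), 0 ≤ g →
        (∀ y' ∈ Λ₁, ‖A y'‖ ≤ tA) →
        (∀ b : HiggsLattice.PBond P k, Inside Λ₁ b → ‖sderiv A b‖ ≤ g) →
      ∀ (x : HiggsLattice.Site P 0), blockIter k x ∈ Λ₂ →
        ‖cutMin C msq a k ζ A x - A (blockIter k x)‖ ≤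
            C₁ * P.d * (P.mesh k * g) + C₂ * Real.exp (-(δ * ρ₁)) * tA
              + msq * P.mesh k ^ 2 / (B1.aSeq a P.L k + msq * P.mesh k ^ 2) * tA
        ∧ ∀ ν : Fin P.d, ‖cutMin C msq a k ζ A (x.shift ν) - cutMin C msq a k ζ A x‖ ≤
            ((P.L : ℝ) ^ k)⁻¹ * (C₁ * P.d * (P.mesh k * g) + C₂ * Real.exp (-(δ * ρ₁)) * tA) := by
  obtain ⟨δ, C₁, C₂, hδ, hC₁, hC₂, h23⟩ := lemma23_higgsLattice d L N hd hL ha hmsq ε₀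
  refine ⟨δ, C₁, C₂, hδ, hC₁, hC₂, ?_⟩
  intro P S hPd hPL C k hk1 hkK hε ζ ρ ρ₁ hρ₁ zeta_abs zeta_supp zeta_one zeta_lip Λ₁ Λ₂ Rn hRn hRn2 hcube A tA g hg hA_abs hA_der
    x hx
  classical
  -- the cube `◇` of radius `R_n` about `ȳ = x_k`, corner `q₁ = ȳ − R_n`
  set ybar := blockIter k x with hybar_def
  set q₁ : HiggsLattice.Site P k := fun ν => ybar ν - (Rn : ZMod (P.sitesPerDir k ν)) with hq₁
  have hcentre : ∀ ν : Fin P.d, (ybar ν - q₁ ν).val = Rn := fun ν => val_centre_sub ybar Rn hRn2 ν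
  set cube : Finset (HiggsLattice.Site P k) := Finset.univ.filter fun y => ∀ ν : Fin P.d, (y ν - q₁ ν).val < 2 * Rn + 1
    with hcube_def
  have mem_cube : ∀ y : HiggsLattice.Site P k, y ∈ cube ↔ ∀ ν : Fin P.d, (y ν - q₁ ν).val < 2 * Rn + 1 := fun y => by
    simp [hcube_def]
  have cube_sub : ∀ y ∈ cube, y ∈ Λ₁ := fun y hy =>
    hcube ybar hx y (tdist_le_of_mem_box q₁ ybar Rn hRn2 hcentre ((mem_cube y).mp hy))
  have hybar_mem : ybar ∈ cube := (mem_cube ybar).mpr (mem_box_of_centre q₁ ybar Rn hcentre)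
  -- r14's hypotheses for `Λ₂ := {ȳ}`, `Λ₁ := ◇`, `q := (Lᵏε)g`, `r₁ := 0`, `r₂ := d`
  have sub : ({ybar} : Finset (HiggsLattice.Site P k)) ⊆ cube := by
    intro y hy
    rw [Finset.mem_singleton] at hy
    rw [hy]; exact hybar_mem
  have nbhd : ∀ (x' : HiggsLattice.Site P 0) (y' : HiggsLattice.Site P k), blockIter k x' ∈ ({ybar} : Finset (HiggsLattice.Site P k)) →
      (HiggsLattice.Site.tdist (blockIter k x') y' : ℝ) ≤ ρ + 1 → y' ∈ cube := by
    intro x' y' hx' hd'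
    rw [Finset.mem_singleton] at hx'
    rw [hx'] at hd'
    have h1 : (HiggsLattice.Site.tdist ybar y' : ℝ) ≤ (Rn : ℝ) := hd'.trans hRn
    have h2 : HiggsLattice.Site.tdist ybar y' ≤ Rn := by exact_mod_cast h1
    exact (mem_cube y').mpr (mem_box_of_tdist_le q₁ ybar Rn hcentre h2)
  have hq : 0 ≤ P.mesh k * g := mul_nonneg (P.mesh_pos k).le hg
  have hA_abs' : ∀ y' ∈ cube, ‖A y'‖ ≤ tA := fun y' hy' => hA_abs y' (cube_sub y' hy')
  -- the per-bond bound telescoped in the cube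
  have hb : ∀ (y : HiggsLattice.Site P k) (μ : Fin P.d), (∀ ν, (y ν - q₁ ν).val < 2 * Rn + 1) →
      (∀ ν, ((y.shift μ) ν - q₁ ν).val < 2 * Rn + 1) → ‖A (y.shift μ) - A y‖ ≤ P.mesh k * g := by
    intro y μ hy hyμ
    have hin : Inside Λ₁ (⟨y, μ⟩ : HiggsLattice.PBond P k) :=
      ⟨cube_sub y ((mem_cube y).mpr hy), cube_sub _ ((mem_cube _).mpr hyμ)⟩
    have e := norm_sub_eq_mesh_mul_norm_sderiv A (⟨y, μ⟩ : HiggsLattice.PBond P k)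
    simp only [HiggsLattice.PBond.tgt] at e
    rw [e]
    exact mul_le_mul_of_nonneg_left (hA_der _ hin) (P.mesh_pos k).le
  have hA_var' : ∀ y ∈ ({ybar} : Finset (HiggsLattice.Site P k)), ∀ y' ∈ cube,
      ‖A y' - A y‖ ≤ P.mesh k * g * (0 + (P.d : ℝ) * (HiggsLattice.Site.tdist y y' : ℝ)) := by
    intro y hy y' hy'
    rw [Finset.mem_singleton] at hy
    subst hy
    have h := lipschitz_about_of_bond_bound q₁ (2 * Rn + 1) hRn2 A hq hb ((mem_cube y').mp hy') (mem_box_of_centre q₁ _ Rn hcentre)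
    calc ‖A y' - A (blockIter k x)‖ ≤ P.mesh k * g * P.d * (HiggsLattice.Site.tdist (blockIter k x) y' : ℝ) := h
      _ = P.mesh k * g * (0 + (P.d : ℝ) * (HiggsLattice.Site.tdist (blockIter k x) y' : ℝ)) := by ring
  have hmain := h23 P S hPd hPL C hk1 hkK hε ζ ρ ρ₁ hρ₁ zeta_abs zeta_supp zeta_one zeta_lip cube {ybar} sub nbhd A tA
    (P.mesh k * g) 0 (P.d : ℝ) hq le_rfl (Nat.cast_nonneg _) hA_abs' hA_var' x (Finset.mem_singleton_self _)
  have e1 : C₁ * (0 + (P.d : ℝ)) * (P.mesh k * g) = C₁ * P.d * (P.mesh k * g) := by ring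
  rw [e1] at hmain
  exact hmain

end Local

/-! ## §3 Lemma 2.3 under the typer's (2.55) -/

section FromRestr255

/-- **LEMMA 2.3 (2.59)–(2.60) «Under the restrictions (2.55)» BY NAME**: for the step's vector field `A′` on `T^{(k)}` (block field
`toSite A′`, `N = d`, part I p.608) obeying the typer's `Restr255 C′ c₁ pℓ t_A tPhi k Λ₁ A′ φ A^{(k)}` — conjunct 1 `|(∂A′)(b)| ≤ c₁pℓ` on the
bonds inside `Λ₁`, conjunct 2 `|A′(x)| ≤ c₁·t_A·pℓ` on `Λ₁` (conjuncts 3–4, on `φ`, unused) —, the cut-off minimizer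
`A^{(k),ε} = a_kζ^{(k)}G_kQ_k^*A′` satisfies `lemma23_local`'s (2.59)/(2.60) with `g := c₁pℓ`, `t_A := c₁·t_A·pℓ`.
[cite: Balaban1982Higgs2, Lemma 2.3 (2.59)–(2.60) p.571, (2.55) p.570, (2.54) p.569, (3.3) p.583, (2.8) p.558] -/
theorem lemma23_restr255 (d L : ℕ) (hd : 1 ≤ d) (hL : Odd L ∧ 1 < L) {a : ℝ} (ha : 0 < a) {msq : ℝ} (hmsq : 0 < msq) (ε₀ : ℝ) :
    ∃ δ C₁ C₂ : ℝ, 0 < δ ∧ 0 < C₁ ∧ 0 < C₂ ∧ ∀ (P : HiggsLattice.Params) (_S : Shape P), P.d = d → P.L = L →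
      ∀ (C : ChargeData P.d) {k : ℕ}, 1 ≤ k → k ≤ P.K → P.mesh k ≤ ε₀ →
      ∀ (ζ : HiggsLattice.Site P 0 → HiggsLattice.Site P k → ℝ) (ρ ρ₁ : ℝ), 0 ≤ ρ₁ →
        (∀ x y', |ζ x y'| ≤ 1) →
        (∀ x y', ζ x y' ≠ 0 → (HiggsLattice.Site.tdist (blockIter k x) y' : ℝ) ≤ ρ) →
        (∀ x y', (HiggsLattice.Site.tdist (blockIter k x) y' : ℝ) ≤ ρ₁ → ζ x y' = 1) →
        (∀ (x : HiggsLattice.Site P 0) (ν : Fin P.d) (y' : HiggsLattice.Site P k), |ζ (x.shift ν) y' - ζ x y'| ≤ ((P.L : ℝ) ^ k)⁻¹) →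
      ∀ (Λ₁ Λ₂ : Finset (HiggsLattice.Site P k)) (Rn : ℕ), ρ + 1 ≤ (Rn : ℝ) → (∀ μ : Fin P.d, 2 * (2 * Rn + 1) ≤ P.sitesPerDir k μ) →
        (∀ y ∈ Λ₂, ∀ y' : HiggsLattice.Site P k, HiggsLattice.Site.tdist y y' ≤ Rn → y' ∈ Λ₁) →
      -- the typer's (2.55) on `Λ₁` for `A′` (and any `φ`, `A^{(k)}` — conjuncts 3–4 unused)
      ∀ {N' : ℕ} (C' : ChargeData N') (A' : HiggsLattice.VecField P k) (φ : HiggsLattice.ScalarField P k N') (Ak : HiggsLattice.VecField P 0)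
        {c₁ pℓ tA tPhi : ℝ}, 0 ≤ c₁ → 0 ≤ pℓ → Restr255 C' c₁ pℓ tA tPhi k Λ₁ A' φ Ak →
      ∀ (x : HiggsLattice.Site P 0), blockIter k x ∈ Λ₂ →
        ‖cutMin C msq a k ζ (toSite A') x - toSite A' (blockIter k x)‖ ≤
            C₁ * P.d * (P.mesh k * (c₁ * pℓ)) + C₂ * Real.exp (-(δ * ρ₁)) * (c₁ * tA * pℓ)
              + msq * P.mesh k ^ 2 / (B1.aSeq a P.L k + msq * P.mesh k ^ 2) * (c₁ * tA * pℓ)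
        ∧ ∀ ν : Fin P.d, ‖cutMin C msq a k ζ (toSite A') (x.shift ν) - cutMin C msq a k ζ (toSite A') x‖ ≤
            ((P.L : ℝ) ^ k)⁻¹ * (C₁ * P.d * (P.mesh k * (c₁ * pℓ)) + C₂ * Real.exp (-(δ * ρ₁)) * (c₁ * tA * pℓ)) := by
  obtain ⟨δ, C₁, C₂, hδ, hC₁, hC₂, h⟩ := lemma23_local d L d hd hL ha hmsq ε₀
  refine ⟨δ, C₁, C₂, hδ, hC₁, hC₂, ?_⟩
  intro P S hPd hPL C k hk1 hkK hε ζ ρ ρ₁ hρ₁ zeta_abs zeta_supp zeta_one zeta_lip Λ₁ Λ₂ Rn hRn hRn2 hcube N' C' A' φ Ak c₁ pℓ tA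
    tPhi hc₁ hpℓ h255 x hx
  subst hPd
  have hA_abs : ∀ y' ∈ Λ₁, ‖toSite A' y'‖ ≤ c₁ * tA * pℓ := fun y' hy' => h255.2.1 y' hy'
  have hA_der : ∀ b : HiggsLattice.PBond P k, Inside Λ₁ b → ‖sderiv (toSite A') b‖ ≤ c₁ * pℓ := fun b hb => h255.1 b hb
  exact h P S rfl hPL C hk1 hkK hε ζ ρ ρ₁ hρ₁ zeta_abs zeta_supp zeta_one zeta_lip Λ₁ Λ₂ Rn hRn hRn2 hcube (toSite A') (c₁ * tA * pℓ)
    (c₁ * pℓ) (mul_nonneg hc₁ hpℓ) hA_abs hA_der x hx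

end FromRestr255

end Literature.MathematicalPhysics.QuantumFieldTheory.Balaban1983to89.B2Lemma23From255

end
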